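import Summits.CriticalPhenomena.PercolationContinuityZ3.Theorems.PercNearOneGluingNoHeavyLowerTailChampionStability
import Summits.CriticalPhenomena.PercolationContinuityZ3.Theorems.PercNearOneGluingAdditiveGluingOneBond
import Summits.CriticalPhenomena.PercolationContinuityZ3.Theorems.PercNearOneGluingNoHeavyLowerTailCILCutObserverTools
import Summits.CriticalPhenomena.PercolationContinuityZ3.Theorems.PercNearOneGluingNoHeavyLowerTailCILOwnEdgeStability
import Literature.Probability.LatticeModels.ProdBernoulliCoupling
import HarnessLib

/-!
# `NoHeavyLowerTail` (stmt-CriticalPhenomena-4575) — tools for AVERAGED port domination (first-open-port events)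

Support file (prover `prim-lf-3`, lemma factory #3; `--supports stmt-CriticalPhenomena-4575`).  No definitions, no named facts,
no sorries.  Measure-theoretic bookkeeping for the first-open-port decomposition of a relay-neighboured observer `o` with ports
`q 0, …, q (d−1)`: the events `F_l = {o–q l open, o–q m closed for m < l}` are determined by the pairs at `o` (so their probability
does not see the other weights), `μ(F_l) = w(o–q l)·μ{earlier pairs closed}`, the `F_l` and `{all pairs closed}` partition the space,
gluing `o` to a relay `a` turns `{1 ≤ N ≤ j}` into `{|π(a)| ≤ j}`, lightness is antitone in one weight, and raising a pair at `a`
(`CutObserver.lightness_raise_le`, imported by the main file).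
Used by `…CILAveragedPortDomination`.
-/

noncomputable section

namespace Summit.CriticalPhenomena.PercolationContinuityZ3.Theorems

open MeasureTheory Set Literature.Probability.LatticeModels Literature.Probability.Percolation
open scoped Classical BigOperators

variable {n : ℕ}

namespace AveragedPort

/-- Lightness is non-increasing when a pair is raised from weight `0` to weight `1`:
`μ_{w[e↦1]}{|π(x)| ≤ j} ≤ μ_{w[e↦0]}{|π(x)| ≤ j}` (the event is decreasing). [folklore] -/
theorem lightness_one_le_zero (w : Sym2 (Fin n) → unitInterval) (A : Finset (Fin n)) (e : Sym2 (Fin n)) (x : Fin n) (j : ℕ) :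
    (prodBernoulli (Function.update w e 1)).real
        {ω : BondConfig (Fin n) | (A.filter fun z => ω ∈ openConn x z).card ≤ j} ≤
      (prodBernoulli (Function.update w e 0)).real
        {ω : BondConfig (Fin n) | (A.filter fun z => ω ∈ openConn x z).card ≤ j} := by
  haveI h1 : IsProbabilityMeasure (prodBernoulli (Function.update w e 1)) := inferInstance
  haveI h0 : IsProbabilityMeasure (prodBernoulli (Function.update w e 0)) := inferInstance
  set L : Set (BondConfig (Fin n)) := {ω : BondConfig (Fin n) | (A.filter fun z => ω ∈ openConn x z).card ≤ j} with hL
  have hup : IsUpperSet Lᶜ := by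
    intro ω ω' hle hω hω'
    apply hω
    simp only [hL, Set.mem_setOf_eq] at hω' ⊢
    refine le_trans (Finset.card_le_card fun z hz => ?_) hω'
    rw [Finset.mem_filter] at hz ⊢
    exact ⟨hz.1, CutObserver.reachable_mono hle hz.2⟩
  have hle : Function.update w e 0 ≤ Function.update w e 1 := by
    intro f
    by_cases hf : f = e
    · subst hf; simp only [Function.update_self]; exact bot_le
    · simp only [Function.update_of_ne hf, le_refl]
  have hc := prodBernoulli_real_mono_of_isUpperSet hle hup MeasurableSet.of_discrete
  have e1 : (prodBernoulli (Function.update w e 1)).real Lᶜ = 1 - (prodBernoulli (Function.update w e 1)).real L :=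
    by rw [measureReal_compl MeasurableSet.of_discrete, probReal_univ]
  have e0 : (prodBernoulli (Function.update w e 0)).real Lᶜ = 1 - (prodBernoulli (Function.update w e 0)).real L :=
    by rw [measureReal_compl MeasurableSet.of_discrete, probReal_univ]
  rw [e1, e0] at hc
  linarith


/-- The first-open-port event `F_l` is determined by the pairs `o–q m`, `m ≤ l`; hence its probability is the same under two weight
functions agreeing on those pairs. [folklore] -/
theorem real_firstOpen_eq_of_agree {d : ℕ} (w w' : Sym2 (Fin n) → unitInterval) (o : Fin n) (q : Fin d → Fin n) (l : Fin d)
    (hww' : ∀ m : Fin d, m ≤ l → w s(o, q m) = w' s(o, q m)) :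
    (prodBernoulli w).real {ω : BondConfig (Fin n) | s(o, q l) ∈ ω ∧ ∀ m, m < l → s(o, q m) ∉ ω} =
      (prodBernoulli w').real {ω : BondConfig (Fin n) | s(o, q l) ∈ ω ∧ ∀ m, m < l → s(o, q m) ∉ ω} := by
  set Early : Finset (Sym2 (Fin n)) := (Finset.univ.filter fun m : Fin d => m ≤ l).image fun m => s(o, q m) with hEarly
  have hdet : DeterminedBy {ω : BondConfig (Fin n) | s(o, q l) ∈ ω ∧ ∀ m, m < l → s(o, q m) ∉ ω}
      (↑Early : Set (Sym2 (Fin n))) := by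
    rw [determinedBy_iff]
    intro ω ω' h
    have key : ∀ m, m ≤ l → (s(o, q m) ∈ ω ↔ s(o, q m) ∈ ω') := by
      intro m hm
      have hmem : s(o, q m) ∈ (↑Early : Set (Sym2 (Fin n))) := by
        rw [Finset.mem_coe, hEarly, Finset.mem_image]
        exact ⟨m, Finset.mem_filter.2 ⟨Finset.mem_univ _, hm⟩, rfl⟩
      have := Set.ext_iff.1 h (s(o, q m))
      simp only [mem_inter_iff, hmem, and_true] at this
      exact this
    simp only [mem_setOf_eq]
    rw [key l le_rfl]
    constructor
    · rintro ⟨h1, h2⟩; exact ⟨h1, fun m hm => (key m hm.le).not.1 (h2 m hm)⟩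
    · rintro ⟨h1, h2⟩; exact ⟨h1, fun m hm => (key m hm.le).not.2 (h2 m hm)⟩
  refine prodBernoulli_real_eq_of_determinedBy w w' (fun f hf => ?_) hdet MeasurableSet.of_discrete
  rw [Finset.mem_coe, hEarly, Finset.mem_image] at hf
  obtain ⟨m, hm, rfl⟩ := hf
  exact hww' m (Finset.mem_filter.1 hm).2

/-- The "all pairs closed" event is determined by those pairs. [folklore] -/
theorem real_allClosed_eq_of_agree {d : ℕ} (w w' : Sym2 (Fin n) → unitInterval) (o : Fin n) (q : Fin d → Fin n)
    (hww' : ∀ m : Fin d, w s(o, q m) = w' s(o, q m)) :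
    (prodBernoulli w).real {ω : BondConfig (Fin n) | ∀ m : Fin d, s(o, q m) ∉ ω} =
      (prodBernoulli w').real {ω : BondConfig (Fin n) | ∀ m : Fin d, s(o, q m) ∉ ω} := by
  set Eset : Finset (Sym2 (Fin n)) := Finset.univ.image fun m : Fin d => s(o, q m) with hE
  have hdet : DeterminedBy {ω : BondConfig (Fin n) | ∀ m : Fin d, s(o, q m) ∉ ω} (↑Eset : Set (Sym2 (Fin n))) := by
    rw [determinedBy_iff]
    intro ω ω' h
    have key : ∀ m : Fin d, (s(o, q m) ∈ ω ↔ s(o, q m) ∈ ω') := by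
      intro m
      have hmem : s(o, q m) ∈ (↑Eset : Set (Sym2 (Fin n))) := by
        rw [Finset.mem_coe, hE, Finset.mem_image]; exact ⟨m, Finset.mem_univ _, rfl⟩
      have := Set.ext_iff.1 h (s(o, q m))
      simp only [mem_inter_iff, hmem, and_true] at this
      exact this
    simp only [mem_setOf_eq]
    exact forall_congr' fun m => (key m).not
  refine prodBernoulli_real_eq_of_determinedBy w w' (fun f hf => ?_) hdet MeasurableSet.of_discrete
  rw [Finset.mem_coe, hE, Finset.mem_image] at hf
  obtain ⟨m, -, rfl⟩ := hf
  exact hww' m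

/-- **Partition by the first open port.**  `Σ_l μ(F_l) + μ{all pairs closed} = 1`. [folklore] -/
theorem sum_real_firstOpen_add_allClosed {d : ℕ} (w : Sym2 (Fin n) → unitInterval) (o : Fin n) (q : Fin d → Fin n) :
    ∑ l : Fin d, (prodBernoulli w).real {ω : BondConfig (Fin n) | s(o, q l) ∈ ω ∧ ∀ m, m < l → s(o, q m) ∉ ω} +
      (prodBernoulli w).real {ω : BondConfig (Fin n) | ∀ m : Fin d, s(o, q m) ∉ ω} = 1 := by
  haveI : IsProbabilityMeasure (prodBernoulli w) := inferInstance
  set F : Fin d → Set (BondConfig (Fin n)) := fun l => {ω | s(o, q l) ∈ ω ∧ ∀ m, m < l → s(o, q m) ∉ ω} with hF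
  set Z : Set (BondConfig (Fin n)) := {ω | ∀ m : Fin d, s(o, q m) ∉ ω} with hZ
  have hdisj : (↑(Finset.univ : Finset (Fin d)) : Set (Fin d)).PairwiseDisjoint F := by
    intro l _ l' _ hne
    rw [Function.onFun, Set.disjoint_left]
    rintro ω ⟨h1, h2⟩ ⟨h1', h2'⟩
    rcases lt_trichotomy l l' with h | h | h
    · exact h2' l h h1
    · exact hne h
    · exact h2 l' h h1'
  have hunion : (⋃ l ∈ (Finset.univ : Finset (Fin d)), F l) = Zᶜ := by
    ext ω
    simp only [mem_iUnion, Finset.mem_univ, exists_true_left, mem_compl_iff, hZ, hF, mem_setOf_eq, not_forall, not_not]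
    constructor
    · rintro ⟨l, hl, -⟩; exact ⟨l, hl⟩
    · rintro ⟨m, hm⟩
      set S := Finset.univ.filter fun m : Fin d => s(o, q m) ∈ ω with hS
      have hSne : S.Nonempty := ⟨m, Finset.mem_filter.2 ⟨Finset.mem_univ _, hm⟩⟩
      refine ⟨S.min' hSne, (Finset.mem_filter.1 (Finset.min'_mem S hSne)).2, fun m' hm' hopen => ?_⟩
      exact absurd hm' (not_lt.2 (Finset.min'_le S m' (Finset.mem_filter.2 ⟨Finset.mem_univ _, hopen⟩)))
  have hsum : ∑ l : Fin d, (prodBernoulli w).real (F l) = (prodBernoulli w).real Zᶜ := by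
    rw [← hunion]
    exact (measureReal_biUnion_finset hdisj fun l _ => MeasurableSet.of_discrete).symm
  rw [hsum, measureReal_compl MeasurableSet.of_discrete, probReal_univ]
  ring

/-- `μ(F_l) = w(o–q l) · μ{pairs o–q m, m < l, closed}`: the pair `o–q l` is independent of the earlier pairs
(`q` injective). [folklore] -/
theorem real_firstOpen_eq_mul {d : ℕ} (w : Sym2 (Fin n) → unitInterval) (o : Fin n) (q : Fin d → Fin n)
    (hq : Function.Injective q) (l : Fin d) :
    (prodBernoulli w).real {ω : BondConfig (Fin n) | s(o, q l) ∈ ω ∧ ∀ m, m < l → s(o, q m) ∉ ω} =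
      (w s(o, q l) : ℝ) * (prodBernoulli w).real {ω : BondConfig (Fin n) | ∀ m, m < l → s(o, q m) ∉ ω} := by
  have hset : {ω : BondConfig (Fin n) | s(o, q l) ∈ ω ∧ ∀ m, m < l → s(o, q m) ∉ ω} =
      {ω | s(o, q l) ∈ ω} ∩ {ω | ∀ m, m < l → s(o, q m) ∉ ω} := by ext ω; simp only [mem_setOf_eq, mem_inter_iff]
  set E1 : Finset (Sym2 (Fin n)) := {s(o, q l)} with hE1
  set E2 : Finset (Sym2 (Fin n)) := (Finset.univ.filter fun m : Fin d => m < l).image fun m => s(o, q m) with hE2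
  have hdisj : Disjoint E1 E2 := by
    rw [Finset.disjoint_left]
    intro f hf hf'
    rw [hE1, Finset.mem_singleton] at hf
    rw [hE2, Finset.mem_image] at hf'
    obtain ⟨m, hm, hmf⟩ := hf'
    rw [hf] at hmf
    have : m = l := hq (Sym2.congr_right.1 hmf)
    exact absurd (Finset.mem_filter.1 hm).2 (this ▸ lt_irrefl _)
  have hA : DeterminedBy {ω : BondConfig (Fin n) | s(o, q l) ∈ ω} (↑E1 : Set (Sym2 (Fin n))) := by
    rw [determinedBy_iff]
    intro ω ω' h
    have := Set.ext_iff.1 h (s(o, q l))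
    simp only [mem_inter_iff, hE1, Finset.coe_singleton, mem_singleton_iff, and_true] at this
    simpa using this
  have hB : DeterminedBy {ω : BondConfig (Fin n) | ∀ m, m < l → s(o, q m) ∉ ω} (↑E2 : Set (Sym2 (Fin n))) := by
    rw [determinedBy_iff]
    intro ω ω' h
    have key : ∀ m, m < l → (s(o, q m) ∈ ω ↔ s(o, q m) ∈ ω') := by
      intro m hm
      have hmem : s(o, q m) ∈ (↑E2 : Set (Sym2 (Fin n))) := by
        rw [Finset.mem_coe, hE2, Finset.mem_image]
        exact ⟨m, Finset.mem_filter.2 ⟨Finset.mem_univ _, hm⟩, rfl⟩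
      have := Set.ext_iff.1 h (s(o, q m))
      simp only [mem_inter_iff, hmem, and_true] at this
      exact this
    simp only [mem_setOf_eq]
    exact forall₂_congr fun m hm => (key m hm).not
  rw [hset, prodBernoulli_real_inter_of_determinedBy_disjoint w hdisj hA hB MeasurableSet.of_discrete
    MeasurableSet.of_discrete, prodBernoulli_real_setOf_mem]

/-- Under `w[s(o,a) ↦ 1]` (from a weight function vanishing at `s(o,a)`), for `a ∈ A`: the observer `o` is glued to the relay `a`,
so `μ{1 ≤ N ≤ j} = μ{|π(a)| ≤ j}`. [folklore] -/
theorem real_bad_update_one_eq (w₀ : Sym2 (Fin n) → unitInterval) (A : Finset (Fin n)) (o a : Fin n) (j : ℕ)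
    (hoa : o ≠ a) (ha : a ∈ A) (hw : w₀ s(o, a) = 0) :
    (prodBernoulli (Function.update w₀ s(o, a) 1)).real {ω : BondConfig (Fin n) |
        1 ≤ (A.filter fun z => ω ∈ openConn o z).card ∧ (A.filter fun z => ω ∈ openConn o z).card ≤ j} =
      (prodBernoulli (Function.update w₀ s(o, a) 1)).real
        {ω : BondConfig (Fin n) | (A.filter fun z => ω ∈ openConn a z).card ≤ j} := by
  rw [ChampionStability.real_update_one_eq w₀ hw, ChampionStability.real_update_one_eq w₀ hw]
  congr 1
  ext ω
  simp only [Set.mem_preimage, Set.mem_setOf_eq]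
  have hadj : (openGraph (insert s(o, a) ω)).Reachable o a :=
    SimpleGraph.Adj.reachable ((openGraph_adj _ o a).2 ⟨Set.mem_insert _ _, hoa⟩)
  have hfilt : (A.filter fun z => insert s(o, a) ω ∈ openConn o z) =
      (A.filter fun z => insert s(o, a) ω ∈ openConn a z) := by
    apply Finset.filter_congr
    intro z _
    simp only [openConn, Set.mem_setOf_eq]
    exact ⟨fun h => hadj.symm.trans h, fun h => hadj.trans h⟩
  rw [hfilt]
  constructor
  · exact fun h => h.2
  · intro h
    refine ⟨Finset.card_pos.2 ⟨a, Finset.mem_filter.2 ⟨ha, ?_⟩⟩, h⟩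
    simp only [openConn, Set.mem_setOf_eq]
    exact SimpleGraph.Reachable.refl _



end AveragedPort

end Summit.CriticalPhenomena.PercolationContinuityZ3.Theorems

end
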